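import Summits.FinalStateConjecture.FinalStateConjecture.Theorems.BartnikGapSettlingSettledCaptureCrushTransportJetStability
import Summits.FinalStateConjecture.FinalStateConjecture.Theorems.BartnikGapSettlingGapExhaustionCylindersBendInwardOf
import Literature.Geometry.Lorentzian.KerrSchildTimeTranslation
import HarnessLib

/-!
# Crux `SettledCapture` (stmt-FinalStateConjecture-17328), line `null-concave-crush`, stub
# `stub_crushTransport` — part 2/5: uniform `C¹`-stability of the Kerr crush certificate

Route `BartnikGapSettling`; helper module (`--supports stmt-FinalStateConjecture-17328`) of the
registered stub `stub_crushTransport`. From the local jet-level stability of part 1/5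
(`crushTransport_good_eventually`) to the uniform statement `crushTransport_perturb`: there is `ε > 0`
such that at every point `y` of the Kerr–Schild shell `{r₋ + δ ≤ r ≤ r₊ − δ}` and for every field of
components `G` with `‖G y − g_{M,a}(y)‖ ≤ ε`, `‖DG(y) − Dg_{M,a}(y)‖ ≤ ε`: `G y` is invertible,
`V_{M,a}(y)` is `G y`-timelike, and for every `G y`-null `w ≠ 0`, `d(F∘r)_y(w) < 0` if `G y (w, V) < 0`,
and `F(r y) · hessAt G (F∘r) y w w ≤ ρ · (d(F∘r)_y w)²`. The time slice `{y⁰ = 0}` of the shell is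
compact (`kerrCylindersBendInward_isCompact_slice` of `Theorems/BartnikGapSettlingGapExhaustionCylindersBendInwardOf.lean`); the tube lemma gives a uniform `ε` over slice × unit sphere;
stationarity of Kerr (`Kerr.bilin_add_smul_basisVector_zero`, `Kerr.radius_add_time_smul_basisVector`,
`Kerr.timeVector_add_smul_basisVector_zero`, naturality of `fderiv` under translations) transports it to
all times, and homogeneity in `w` removes the normalisation.

## References
* B. O'Neill, *Semi-Riemannian geometry with applications to relativity*, Academic Press 1983, Ch. 3,
  Cor. 21, Lemma 22, Lemma 3.49, Prop. 3.59 and pp. 90–91; Ch. 5, Lemma 5.26, Lemma 5.29. [ONeill1983]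
* M. Dafermos, I. Rodnianski, arXiv:0811.0354, §5.1 (ingoing Kerr–Schild coordinates). [arXiv08110354]
* M. Dafermos, J. Luk, arXiv:1710.01722 (the Kerr interior: red-shift and no-shift regions). [DafermosLuk2017]
-/

noncomputable section

-- instance search through the nested operator types `E4 →L[ℝ] E4 →L[ℝ] E4 →L[ℝ] ℝ`
set_option maxSynthPendingDepth 3

-- D-0017: single-problem summit, `Summit.<S>.<S>.…` by design (cf. lakefile `weak.linter.dupNamespace`).
set_option linter.dupNamespace false

namespace Summit.FinalStateConjecture.FinalStateConjecture.Theorems.BartnikGapSettling.SettledCapture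

open Set Filter Function TopologicalSpace
open scoped Manifold ContDiff Topology ENNReal
open Literature.Geometry.Lorentzian Literature.Geometry.Lorentzian.MetricCoord

section Perturbation

/-- **`C¹`-stability of the Kerr crush certificate** (the coordinate-perturbation half of the stub): a
certificate with margin `m > 0` for exact Kerr `(M, a)` on the shell `{r₋ + δ ≤ r ≤ r₊ − δ}` survives,
margin-free, for every field of components `G` whose `1`-jet at the shell point is `ε`-close to that of
`g_{M,a}`: `G y` is invertible, the Kerr field `V` is `G y`-timelike, and for every `G y`-null `w ≠ 0`,
`d(F∘r)_y(w) < 0` whenever `G y (w, V) < 0`, and `F(r y) · hessAt G (F∘r) y w w ≤ ρ · (d(F∘r)_y w)²`.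
Compactness of the time slice of the shell times the unit sphere (`crushTransport_tube`, `crushTransport_good_eventually`)
and stationarity of Kerr (`Kerr.bilin_add_smul_basisVector_zero`, `Kerr.radius_add_time_smul_basisVector`,
`Kerr.timeVector_add_smul_basisVector_zero`). [folklore] -/
theorem crushTransport_perturb {M a δ ρ m : ℝ} {F : ℝ → ℝ} (hM : 0 < M) (ha : |a| < M) (hδ : 0 < δ)
    (hm : 0 < m) (hcert : KerrCrushCertificate M a (Kerr.rMinus M a + δ) (Kerr.rPlus M a - δ) ρ m F) :
    ∃ ε : ℝ, 0 < ε ∧ ∀ y : E4, Kerr.rMinus M a + δ ≤ Kerr.radius a y →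
      Kerr.radius a y ≤ Kerr.rPlus M a - δ →
      ∀ G : E4 → E4 →L[ℝ] E4 →L[ℝ] ℝ, ‖G y - Kerr.bilin M a y‖ ≤ ε →
        ‖fderiv ℝ G y - fderiv ℝ (Kerr.bilin M a) y‖ ≤ ε →
        (G y).IsInvertible ∧ G y (Kerr.timeVector M a y) (Kerr.timeVector M a y) < 0 ∧
        ∀ w : E4, G y w w = 0 → w ≠ 0 →
          (G y w (Kerr.timeVector M a y) < 0 → fderiv ℝ (F ∘ Kerr.radius a) y w < 0) ∧
          F (Kerr.radius a y) * hessAt G (F ∘ Kerr.radius a) y w w ≤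
            ρ * fderiv ℝ (F ∘ Kerr.radius a) y w ^ 2 := by
  have hr0 : 0 < Kerr.rMinus M a + δ := by
    have := Kerr.IsSubextremal.rMinus_nonneg (M := M) (a := a) ha
    linarith
  set K : Set E4 := {z | z 0 = 0 ∧ Kerr.rMinus M a + δ ≤ Kerr.radius a z ∧
    Kerr.radius a z ≤ Kerr.rPlus M a - δ} with hKdef
  have hK : IsCompact K :=
    Summit.FinalStateConjecture.FinalStateConjecture.Theorems.kerrCylindersBendInward_isCompact_slice a _ hr0
  have hev : ∀ z ∈ K ×ˢ Metric.sphere (0 : E4) 1, ∀ᶠ q in 𝓝 ((z, 0) : (E4 × E4) × ((E4 →L[ℝ] E4 →L[ℝ] ℝ) × (E4 →L[ℝ] E4 →L[ℝ] E4 →L[ℝ] ℝ))),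
      (Kerr.bilin M a q.1.1 + q.2.1).IsInvertible ∧ (Kerr.bilin M a q.1.1 + q.2.1) (Kerr.timeVector M a q.1.1) (Kerr.timeVector M a q.1.1) < 0 ∧
        ((Kerr.bilin M a q.1.1 + q.2.1) q.1.2 q.1.2 = 0 →
          ((Kerr.bilin M a q.1.1 + q.2.1) q.1.2 (Kerr.timeVector M a q.1.1) < 0 → fderiv ℝ (F ∘ Kerr.radius a) q.1.1 q.1.2 < 0) ∧
            F (Kerr.radius a q.1.1) * (fderiv ℝ (fderiv ℝ (F ∘ Kerr.radius a)) q.1.1 q.1.2 q.1.2 - fderiv ℝ (F ∘ Kerr.radius a) q.1.1 ((2⁻¹ : ℝ) • (Kerr.bilin M a q.1.1 + q.2.1).inverse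
              (koszulOp (fderiv ℝ (Kerr.bilin M a) q.1.1 + q.2.2) q.1.2 q.1.2))) - ρ * fderiv ℝ (F ∘ Kerr.radius a) q.1.1 q.1.2 ^ 2 < 0) := by
    rintro ⟨y, v⟩ ⟨hy, hv⟩
    have hv0 : v ≠ 0 := by
      intro h
      rw [h, mem_sphere_zero_iff_norm, norm_zero] at hv
      exact zero_ne_one hv
    exact crushTransport_good_eventually hM.le hm hcert (hr0.trans_le hy.2.1) hy.2.1 hy.2.2 hv0
  obtain ⟨ε, hε, hgood⟩ := crushTransport_tube (hK.prod (isCompact_sphere (0 : E4) 1)) hev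
  refine ⟨ε, hε, fun y hy₁ hy₂ G hG hdG => ?_⟩
  -- translate `y` to the time slice: `y = y' + t ∂₀`
  obtain ⟨t, ht⟩ : ∃ t : ℝ, y 0 = t := ⟨_, rfl⟩
  obtain ⟨y', hy'y⟩ : ∃ y' : E4, y' + t • E4.basisVector 0 = y :=
    ⟨y - t • E4.basisVector 0, sub_add_cancel y _⟩
  have hy'0 : y' 0 = 0 := by
    have h : (y' + t • E4.basisVector 0) 0 = y 0 := by rw [hy'y]
    rw [ht] at h
    simpa [E4.basisVector] using h
  -- stationarity of Kerr: the jets at `y'` are those at `y`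
  have hradfun : (fun z : E4 => Kerr.radius a (z + t • E4.basisVector 0)) = Kerr.radius a :=
    funext fun z => Kerr.radius_add_time_smul_basisVector a z t
  have hffun : (fun z : E4 => (F ∘ Kerr.radius a) (z + t • E4.basisVector 0)) = F ∘ Kerr.radius a := by
    funext z
    simp only [comp_apply, Kerr.radius_add_time_smul_basisVector]
  have hbilfun : (fun z : E4 => Kerr.bilin M a (z + t • E4.basisVector 0)) = Kerr.bilin M a :=
    funext fun z => Kerr.bilin_add_smul_basisVector_zero M a z t
  have e_r : Kerr.radius a y' = Kerr.radius a y := by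
    rw [← hy'y, Kerr.radius_add_time_smul_basisVector]
  have e_g : Kerr.bilin M a y' = Kerr.bilin M a y := by
    rw [← hy'y, Kerr.bilin_add_smul_basisVector_zero]
  have e_V : Kerr.timeVector M a y' = Kerr.timeVector M a y := by
    rw [← hy'y, Kerr.timeVector_add_smul_basisVector_zero]
  have e_dg : fderiv ℝ (Kerr.bilin M a) y' = fderiv ℝ (Kerr.bilin M a) y := by
    rw [← hy'y, ← fderiv_comp_add_right (t • E4.basisVector 0)]
    exact (congrArg (fun g : E4 → E4 →L[ℝ] E4 →L[ℝ] ℝ => fderiv ℝ g y') hbilfun).symm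
  have hdffun : (fun z : E4 => fderiv ℝ (F ∘ Kerr.radius a) (z + t • E4.basisVector 0)) =
      fderiv ℝ (F ∘ Kerr.radius a) := by
    funext z
    rw [← fderiv_comp_add_right (t • E4.basisVector 0)]
    exact congrArg (fun g : E4 → ℝ => fderiv ℝ g z) hffun
  have e_df : fderiv ℝ (F ∘ Kerr.radius a) y' = fderiv ℝ (F ∘ Kerr.radius a) y := by
    rw [← hy'y]
    exact (congrFun hdffun y').symm
  have e_ddf : fderiv ℝ (fderiv ℝ (F ∘ Kerr.radius a)) y' = fderiv ℝ (fderiv ℝ (F ∘ Kerr.radius a)) y := by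
    rw [← hy'y, ← fderiv_comp_add_right (t • E4.basisVector 0)]
    exact (congrArg (fun g : E4 → E4 →L[ℝ] ℝ => fderiv ℝ g y') hdffun).symm
  have hy'K : y' ∈ K := ⟨hy'0, hy₁.trans_eq e_r.symm, e_r.trans_le hy₂⟩
  -- the jet perturbation at `y`
  set p : ((E4 →L[ℝ] E4 →L[ℝ] ℝ) × (E4 →L[ℝ] E4 →L[ℝ] E4 →L[ℝ] ℝ)) := (G y - Kerr.bilin M a y, fderiv ℝ G y - fderiv ℝ (Kerr.bilin M a) y) with hpdef
  have hp : ‖p‖ ≤ ε := max_le hG hdG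
  have hG' : Kerr.bilin M a y + p.1 = G y := by simp [hpdef]
  have hdG' : fderiv ℝ (Kerr.bilin M a) y + p.2 = fderiv ℝ G y := by simp [hpdef]
  have key : ∀ v : E4, ‖v‖ = 1 →
      (Kerr.bilin M a y + p.1).IsInvertible ∧ (Kerr.bilin M a y + p.1) (Kerr.timeVector M a y) (Kerr.timeVector M a y) < 0 ∧
        ((Kerr.bilin M a y + p.1) v v = 0 →
          ((Kerr.bilin M a y + p.1) v (Kerr.timeVector M a y) < 0 → fderiv ℝ (F ∘ Kerr.radius a) y v < 0) ∧
            F (Kerr.radius a y) * (fderiv ℝ (fderiv ℝ (F ∘ Kerr.radius a)) y v v - fderiv ℝ (F ∘ Kerr.radius a) y ((2⁻¹ : ℝ) • (Kerr.bilin M a y + p.1).inverse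
              (koszulOp (fderiv ℝ (Kerr.bilin M a) y + p.2) v v))) - ρ * fderiv ℝ (F ∘ Kerr.radius a) y v ^ 2 < 0) := by
    intro v hv
    have h := hgood (y', v) ⟨hy'K, mem_sphere_zero_iff_norm.2 hv⟩ p hp
    dsimp only at h
    rw [e_g, e_dg, e_V, e_r, e_df, e_ddf] at h
    exact h
  -- the direction-independent conclusions
  have hunit : ‖(E4.basisVector 0 : E4)‖ = 1 := by simp [E4.basisVector]
  obtain ⟨hinv, hVV, -⟩ := key (E4.basisVector 0) hunit
  rw [hG'] at hinv hVV
  refine ⟨hinv, hVV, fun w hw hw0 => ?_⟩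
  -- normalise the direction
  have hn : 0 < ‖w‖ := norm_pos_iff.2 hw0
  have hc : 0 < ‖w‖⁻¹ := inv_pos.2 hn
  have hv1 : ‖‖w‖⁻¹ • w‖ = 1 := by
    rw [norm_smul, norm_inv, norm_norm, inv_mul_cancel₀ hn.ne']
  obtain ⟨-, -, himp⟩ := key (‖w‖⁻¹ • w) hv1
  rw [hG', hdG'] at himp
  have hvv : G y (‖w‖⁻¹ • w) (‖w‖⁻¹ • w) = 0 := by
    simp only [map_smul, smul_apply, hw, smul_eq_mul, mul_zero]
  obtain ⟨hslope, hconc⟩ := himp hvv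
  have e2 : fderiv ℝ (F ∘ Kerr.radius a) y (‖w‖⁻¹ • w) = ‖w‖⁻¹ * fderiv ℝ (F ∘ Kerr.radius a) y w := by
    rw [map_smul, smul_eq_mul]
  constructor
  · intro hfut
    have hfut' : G y (‖w‖⁻¹ • w) (Kerr.timeVector M a y) < 0 := by
      have e : G y (‖w‖⁻¹ • w) (Kerr.timeVector M a y) = ‖w‖⁻¹ * G y w (Kerr.timeVector M a y) := by
        rw [map_smul, smul_apply, smul_eq_mul]
      rw [e]
      exact mul_neg_of_pos_of_neg hc hfut
    have h := hslope hfut'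
    rw [e2] at h
    exact lt_of_mul_lt_mul_left (by rwa [mul_zero]) hc.le
  · have hH : hessAt G (F ∘ Kerr.radius a) y (‖w‖⁻¹ • w) (‖w‖⁻¹ • w) =
        fderiv ℝ (fderiv ℝ (F ∘ Kerr.radius a)) y (‖w‖⁻¹ • w) (‖w‖⁻¹ • w) -
          fderiv ℝ (F ∘ Kerr.radius a) y ((2⁻¹ : ℝ) •
            (G y).inverse (koszulOp (fderiv ℝ G y) (‖w‖⁻¹ • w) (‖w‖⁻¹ • w))) := by
      rw [hessAt_apply, chrAt_apply]
      rfl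
    rw [← hH] at hconc
    have e1 : hessAt G (F ∘ Kerr.radius a) y (‖w‖⁻¹ • w) (‖w‖⁻¹ • w) =
        ‖w‖⁻¹ * (‖w‖⁻¹ * hessAt G (F ∘ Kerr.radius a) y w w) := by
      simp only [map_smul, smul_apply, smul_eq_mul]
    rw [e1, e2] at hconc
    have hfac : F (Kerr.radius a y) * (‖w‖⁻¹ * (‖w‖⁻¹ * hessAt G (F ∘ Kerr.radius a) y w w)) -
        ρ * (‖w‖⁻¹ * fderiv ℝ (F ∘ Kerr.radius a) y w) ^ 2 =
        ‖w‖⁻¹ ^ 2 * (F (Kerr.radius a y) * hessAt G (F ∘ Kerr.radius a) y w w -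
          ρ * fderiv ℝ (F ∘ Kerr.radius a) y w ^ 2) := by ring
    rw [hfac] at hconc
    have h := lt_of_mul_lt_mul_left (b := F (Kerr.radius a y) * hessAt G (F ∘ Kerr.radius a) y w w -
      ρ * fderiv ℝ (F ∘ Kerr.radius a) y w ^ 2) (c := (0 : ℝ)) (by rwa [mul_zero]) (pow_pos hc 2).le
    linarith

/-- **Registered sub-goal `stub_crushTransportPerturb`** (helper of stub `stub_crushTransport`, line
`null-concave-crush`): the uniform `C¹`-stability of the Kerr crush certificate, i.e. `crushTransport_perturb`
in registered one-line form. [folklore] -/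
theorem stub_crushTransportPerturb : ∀ (M a δ ρ m : ℝ) (F : ℝ → ℝ), 0 < M → |a| < M → 0 < δ → 0 < m → KerrCrushCertificate M a (Kerr.rMinus M a + δ) (Kerr.rPlus M a - δ) ρ m F → ∃ ε : ℝ, 0 < ε ∧ ∀ (y : E4), Kerr.rMinus M a + δ ≤ Kerr.radius a y → Kerr.radius a y ≤ Kerr.rPlus M a - δ → ∀ G : E4 → E4 →L[ℝ] E4 →L[ℝ] ℝ, ‖G y - Kerr.bilin M a y‖ ≤ ε → ‖fderiv ℝ G y - fderiv ℝ (Kerr.bilin M a) y‖ ≤ ε → (G y).IsInvertible ∧ G y (Kerr.timeVector M a y) (Kerr.timeVector M a y) < 0 ∧ ∀ w : E4, G y w w = 0 → w ≠ 0 → (G y w (Kerr.timeVector M a y) < 0 → fderiv ℝ (F ∘ Kerr.radius a) y w < 0) ∧ F (Kerr.radius a y) * MetricCoord.hessAt G (F ∘ Kerr.radius a) y w w ≤ ρ * fderiv ℝ (F ∘ Kerr.radius a) y w ^ 2 := by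
  intro M a δ ρ m F hM ha hδ hm hcert
  exact crushTransport_perturb hM ha hδ hm hcert

end Perturbation

end Summit.FinalStateConjecture.FinalStateConjecture.Theorems.BartnikGapSettling.SettledCapture

end
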